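import Mathlib.Analysis.SpecialFunctions.Pow.Real
import Mathlib.Analysis.SpecialFunctions.Sqrt
import HarnessLib

/-!
# The explicit error terms of the mixing estimates (Aizenman–Duminil-Copin 2021, §6.2: (6.16), Prop. 6.6, Lemma 6.7, (6.9))

Topic `Literature/Probability/LatticeModels`. Definitions with bodies and elementary bounds; **no named fact
is introduced** (D-0026).

Abbreviations for the explicit real error terms produced by the finite-volume mixing estimates
(`MixingBoxAAAG.box_mixingCore_prob`: `√(q²-1) + E`; `MixingBoxRelocation.box_relocation_regular`), so that the
asymptotic bookkeeping of the proof of Theorem 6.4 — "`≤ C₅s/√log(N/n) + 2C₆s(n/N)^ε`" — can be carried out on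
short expressions: `twoSiteConst` (the constant of (6.5)), `concErr` (`√(q²-1)`), `eoff`, `splitErr` (Lemma 6.7),
`odErr` ((6.9), regular case), with the elementary bounds `eoff_le`, `chainOutTerm_le`, `chainInTerm_le`,
`concErr_le` used to show that they are small.

## References

* M. Aizenman, H. Duminil-Copin, Ann. of Math. 194 (2021), arXiv:1912.07973, §6.2, (6.13)–(6.16), Prop. 6.6,
  Lemma 6.7 (pp. 23–26) [AizenmanDuminilCopinAnnals2021].
-/

noncomputable section

namespace Literature.Probability.LatticeModels

/-! ### The explicit error terms -/

/-- The constant `C_*` of the two-site numerics (6.5) in `d = 4` (`TwoSiteNumerics.sum_inv_mul_sum_twoSiteTerm_le`).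
[cite: AizenmanDuminilCopinAnnals2021, arXiv:1912.07973 §6.2, (6.4)–(6.5) (p. 23)] -/
def twoSiteConst (c C κ γ : ℝ) : ℝ :=
  (2 * C * ((1 + (1 + c) / c) * 9 ^ 4 * C ^ 2 * (1 + κ) / γ)) + 4 * ((1 + κ) * C + (2 * C + κ + 2 * C * κ))

/-- The concentration error `√(q²-1)`, `q = (1-η)⁻⁵(1 + C_*/|𝒦|)` ("`C₅s/√log(N/n)`").
[cite: AizenmanDuminilCopinAnnals2021, arXiv:1912.07973 §6.2, (6.13) and Prop. 6.6 (p. 24)] -/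
def concErr (c C κ γ η : ℝ) (nK : ℕ) : ℝ :=
  Real.sqrt (((1 - η)⁻¹ ^ 5 * (1 + twoSiteConst c C κ γ / nK)) ^ 2 - 1)

/-- The off-part crossing term `216a³·216b³(C_IR/(b-a)²)²` ("`C₃R³N³(R/N)⁴`"). [cite: AizenmanDuminilCopinAnnals2021, arXiv:1912.07973 §6.2, (6.12) (p. 25)] -/
def eoff (CIR : ℝ) (a b : ℕ) : ℝ := (216 * (a : ℝ) ^ 3) * (216 * (b : ℝ) ^ 3) * (CIR / ((b - a : ℕ) : ℝ) ^ 2) ^ 2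

/-- The split-event error of Lemma 6.7 (`MixingBoxSplitNumerics.splitFail_hG_real`) ("`2C₆s(n/N)^ε`").
[cite: AizenmanDuminilCopinAnnals2021, arXiv:1912.07973 §6.2, Lemma 6.7 (p. 24)] -/
def splitErr (CIR η sW θ : ℝ) (n₀ r mℓ m₀ M₃ R N₄ : ℕ) : ℝ :=
  2 * (eoff CIR M₃ (N₄ + 1) + eoff CIR n₀ (m₀ + 1)) +
    2 * ((216 * (R : ℝ) ^ 3) * ((CIR / (R : ℝ) ^ 2) * (CIR / ((R - M₃ : ℕ) : ℝ) ^ 2)) / ((1 - η) * sW) +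
      eoff CIR R (N₄ + 1) + θ * (216 * (r : ℝ) ^ 3) * (CIR / ((mℓ - r : ℕ) : ℝ) ^ 2) / (1 - η) + eoff CIR n₀ r)

/-- The error of (6.9) in the regular case (`box_relocation_regular`): twice the (6.16) error for regular far
sources (`κ = 8C`, `γ = 1/16`, `θ = 1 + 4C`) plus the closeness of the switch weights.
[cite: AizenmanDuminilCopinAnnals2021, arXiv:1912.07973 §6.2, derivation of (6.9) (p. 26)] -/
def odErr (c C CIR η sW ζ : ℝ) (nK : ℕ) (n₀ r mℓ m₀ M₃ R N₄ : ℕ) : ℝ :=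
  2 * (concErr c C (8 * C) (1 / 16) η nK + splitErr CIR η sW (1 + 4 * C) n₀ r mℓ m₀ M₃ R N₄ +
    ((1 + ζ) ^ 4 / (1 - η) ^ 4 - 1))

/-! ### Elementary bounds -/

/-- `C_* ≥ 0`. [folklore] -/
theorem twoSiteConst_nonneg {c C κ γ : ℝ} (hc : 0 < c) (hC : 0 ≤ C) (hκ : 0 ≤ κ) (hγ : 0 < γ) :
    0 ≤ twoSiteConst c C κ γ := by
  unfold twoSiteConst; positivity

/-- **The off-part term is `≤ 746496 C_IR² a³/b`** for `1 ≤ a`, `2a ≤ b` ("`C₃R³N³(R/N)⁴`"). [folklore] -/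
theorem eoff_le {CIR : ℝ} {a b : ℕ} (ha : 1 ≤ a) (hab : 2 * a ≤ b) :
    eoff CIR a b ≤ 746496 * CIR ^ 2 * (a : ℝ) ^ 3 / b := by
  unfold eoff
  have hb : (0 : ℝ) < b := by exact_mod_cast (show 0 < b by omega)
  have hba : ((b - a : ℕ) : ℝ) = b - a := by push_cast [Nat.cast_sub (show a ≤ b by omega)]; ring
  have hba2 : (b : ℝ) / 2 ≤ b - a := by
    have : (2 * a : ℝ) ≤ b := by exact_mod_cast hab
    linarith
  have hba0 : (0 : ℝ) < b - a := by linarith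
  rw [hba, div_pow, show (216 * (a : ℝ) ^ 3) * (216 * (b : ℝ) ^ 3) * (CIR ^ 2 / ((b - a) ^ 2) ^ 2) =
    46656 * CIR ^ 2 * (a : ℝ) ^ 3 * ((b : ℝ) ^ 3 / (b - a) ^ 4) by ring]
  have hkey : (b : ℝ) ^ 3 / (b - a) ^ 4 ≤ 16 / b := by
    rw [div_le_div_iff₀ (by positivity) hb]
    have h4 : ((b : ℝ) / 2) ^ 4 ≤ (b - a) ^ 4 := pow_le_pow_left₀ (by positivity) hba2 4
    nlinarith [h4]
  calc 46656 * CIR ^ 2 * (a : ℝ) ^ 3 * ((b : ℝ) ^ 3 / (b - a) ^ 4)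
      ≤ 46656 * CIR ^ 2 * (a : ℝ) ^ 3 * (16 / b) := mul_le_mul_of_nonneg_left hkey (by positivity)
    _ = 746496 * CIR ^ 2 * (a : ℝ) ^ 3 / b := by ring

/-- **The outward chain-rule term is `≤ 864 C_IR²/(R(1-η)s_W)`** for `2M ≤ R`, `R ≥ 1` ("`C₂R³M³/R⁴`" once
`s_W ≍ M⁻³`). [folklore] -/
theorem chainOutTerm_le {CIR η sW : ℝ} {M R : ℕ} (hR : 1 ≤ R) (hMR : 2 * M ≤ R) (hη : η < 1) (hsW : 0 < sW) :
    (216 * (R : ℝ) ^ 3) * ((CIR / (R : ℝ) ^ 2) * (CIR / ((R - M : ℕ) : ℝ) ^ 2)) / ((1 - η) * sW) ≤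
      864 * CIR ^ 2 / ((R : ℝ) * ((1 - η) * sW)) := by
  have hR0 : (0 : ℝ) < R := by exact_mod_cast (show 0 < R by omega)
  have hRM : ((R - M : ℕ) : ℝ) = R - M := by push_cast [Nat.cast_sub (show M ≤ R by omega)]; ring
  have hRM2 : (R : ℝ) / 2 ≤ R - M := by
    have : (2 * M : ℝ) ≤ R := by exact_mod_cast hMR
    linarith
  have h1η : 0 < 1 - η := by linarith
  rw [hRM, div_le_div_iff₀ (mul_pos h1η hsW) (mul_pos hR0 (mul_pos h1η hsW))]
  have hRMpos : (0 : ℝ) < R - M := by linarith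
  have hRM0 : (R : ℝ) - M ≠ 0 := hRMpos.ne'
  have hkey : (216 * (R : ℝ) ^ 3) * ((CIR / (R : ℝ) ^ 2) * (CIR / (R - M) ^ 2)) * R ≤ 864 * CIR ^ 2 := by
    rw [show (216 * (R : ℝ) ^ 3) * ((CIR / (R : ℝ) ^ 2) * (CIR / (R - M) ^ 2)) * R =
      216 * CIR ^ 2 * ((R : ℝ) ^ 4 / ((R : ℝ) ^ 2 * (R - M) ^ 2)) by field_simp]
    have h2 : ((R : ℝ) / 2) ^ 2 ≤ (R - M) ^ 2 := pow_le_pow_left₀ (by positivity) hRM2 2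
    have hfrac : (R : ℝ) ^ 4 / ((R : ℝ) ^ 2 * (R - M) ^ 2) ≤ 4 := by
      rw [div_le_iff₀ (mul_pos (pow_pos hR0 2) (pow_pos hRMpos 2))]; nlinarith [h2, pow_pos hR0 2]
    nlinarith [hfrac, sq_nonneg CIR]
  calc (216 * (R : ℝ) ^ 3) * ((CIR / (R : ℝ) ^ 2) * (CIR / (R - M) ^ 2)) * ((R : ℝ) * ((1 - η) * sW))
      = ((216 * (R : ℝ) ^ 3) * ((CIR / (R : ℝ) ^ 2) * (CIR / (R - M) ^ 2)) * R) * ((1 - η) * sW) := by ring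
    _ ≤ 864 * CIR ^ 2 * ((1 - η) * sW) := mul_le_mul_of_nonneg_right hkey (by positivity)

/-- **The inward chain-rule term is `≤ 864 θ C_IR r³/(m²(1-η))`** for `2r ≤ m`, `m ≥ 1` ("`C₅r³/m²`"). [folklore] -/
theorem chainInTerm_le {CIR η θ : ℝ} {r m : ℕ} (hm : 1 ≤ m) (hrm : 2 * r ≤ m) (hη : η < 1) (hθ : 0 ≤ θ) (hC : 0 ≤ CIR) :
    θ * (216 * (r : ℝ) ^ 3) * (CIR / ((m - r : ℕ) : ℝ) ^ 2) / (1 - η) ≤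
      864 * θ * CIR * (r : ℝ) ^ 3 / ((m : ℝ) ^ 2 * (1 - η)) := by
  have hm0 : (0 : ℝ) < m := by exact_mod_cast (show 0 < m by omega)
  have hmr : ((m - r : ℕ) : ℝ) = m - r := by push_cast [Nat.cast_sub (show r ≤ m by omega)]; ring
  have hmr2 : (m : ℝ) / 2 ≤ m - r := by
    have : (2 * r : ℝ) ≤ m := by exact_mod_cast hrm
    linarith
  have h1η : 0 < 1 - η := by linarith
  rw [hmr, div_le_div_iff₀ h1η (by positivity)]
  have h2 : ((m : ℝ) / 2) ^ 2 ≤ (m - r) ^ 2 := pow_le_pow_left₀ (by positivity) hmr2 2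
  have hfrac : CIR / ((m : ℝ) - r) ^ 2 ≤ 4 * CIR / (m : ℝ) ^ 2 := by
    rw [div_le_div_iff₀ (by nlinarith [pow_pos hm0 2]) (by positivity)]
    nlinarith [h2, hC]
  calc θ * (216 * (r : ℝ) ^ 3) * (CIR / ((m : ℝ) - r) ^ 2) * ((m : ℝ) ^ 2 * (1 - η))
      ≤ θ * (216 * (r : ℝ) ^ 3) * (4 * CIR / (m : ℝ) ^ 2) * ((m : ℝ) ^ 2 * (1 - η)) := by
        have : 0 ≤ θ * (216 * (r : ℝ) ^ 3) := by positivity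
        have : 0 ≤ (m : ℝ) ^ 2 * (1 - η) := by positivity
        gcongr
    _ = θ * (216 * (r : ℝ) ^ 3) * (4 * CIR) * (1 - η) * ((m : ℝ) ^ 2 / (m : ℝ) ^ 2) := by ring
    _ = 864 * θ * CIR * (r : ℝ) ^ 3 * (1 - η) := by rw [div_self (pow_ne_zero 2 hm0.ne'), mul_one]; ring

/-- `(1-η)⁻⁵ ≤ 1 + 15η` for `0 ≤ η ≤ 1/10`. [folklore] -/
theorem inv_one_sub_pow_five_le {η : ℝ} (hη0 : 0 ≤ η) (hη : η ≤ 1 / 10) : (1 - η)⁻¹ ^ 5 ≤ 1 + 15 * η := by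
  have h1η : 0 < 1 - η := by linarith
  have hinv : (1 - η)⁻¹ ≤ 1 + 2 * η := by
    rw [inv_le_iff_one_le_mul₀ h1η]; nlinarith
  have h0 : 0 ≤ (1 - η)⁻¹ := by positivity
  calc (1 - η)⁻¹ ^ 5 ≤ (1 + 2 * η) ^ 5 := pow_le_pow_left₀ h0 hinv 5
    _ ≤ 1 + 15 * η := by nlinarith [sq_nonneg η, mul_nonneg hη0 hη0, pow_nonneg hη0 3, pow_nonneg hη0 4, pow_nonneg hη0 5]

/-- **The concentration error with `η = 1/|𝒦|`**: for `|𝒦| ≥ 10`, `concErr ≤ √(2A + A²)/√|𝒦|` with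
`A = 15 + 16 C_*` ("`C₅s/√log(N/n)`"). [folklore] -/
theorem concErr_le {c C κ γ : ℝ} (hc : 0 < c) (hC : 0 ≤ C) (hκ : 0 ≤ κ) (hγ : 0 < γ) {nK : ℕ} (hn : 10 ≤ nK) :
    concErr c C κ γ (1 / nK) nK ≤
      Real.sqrt (2 * (15 + 16 * twoSiteConst c C κ γ) + (15 + 16 * twoSiteConst c C κ γ) ^ 2) / Real.sqrt nK := by
  set Cst := twoSiteConst c C κ γ with hCst
  have hCst0 : 0 ≤ Cst := twoSiteConst_nonneg hc hC hκ hγ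
  set A : ℝ := 15 + 16 * Cst with hA
  have hA0 : 0 ≤ A := by rw [hA]; positivity
  have hn0 : (0 : ℝ) < nK := by exact_mod_cast (show 0 < nK by omega)
  have hn10 : (10 : ℝ) ≤ nK := by exact_mod_cast hn
  set η : ℝ := 1 / nK with hη
  have hη0 : 0 ≤ η := by rw [hη]; positivity
  have hη10 : η ≤ 1 / 10 := by rw [hη]; exact one_div_le_one_div_of_le (by norm_num) hn10
  have hηn : η * nK = 1 := by rw [hη]; field_simp
  -- `q ≤ 1 + A/nK`
  set q : ℝ := (1 - η)⁻¹ ^ 5 * (1 + Cst / nK) with hq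
  have hq1 : 1 ≤ q := by
    rw [hq]
    have h1 : 1 ≤ (1 - η)⁻¹ ^ 5 := one_le_pow₀ (by
      rw [le_inv_comm₀ one_pos (by linarith), inv_one]; linarith)
    have h2 : (1 : ℝ) ≤ 1 + Cst / nK := by
      have : 0 ≤ Cst / nK := by positivity
      linarith
    exact one_le_mul_of_one_le_of_one_le h1 h2
  have hqle : q ≤ 1 + A / nK := by
    rw [hq, hA]
    have h5 := inv_one_sub_pow_five_le hη0 hη10
    have hc1 : 0 ≤ Cst / nK := by positivity
    calc (1 - η)⁻¹ ^ 5 * (1 + Cst / nK) ≤ (1 + 15 * η) * (1 + Cst / nK) := mul_le_mul_of_nonneg_right h5 (by linarith)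
      _ = 1 + (15 + Cst + 15 * η * Cst) / nK := by rw [hη]; field_simp; ring
      _ ≤ 1 + (15 + 16 * Cst) / nK := by
          have h : 15 + Cst + 15 * η * Cst ≤ 15 + 16 * Cst := by nlinarith [mul_nonneg hη0 hCst0]
          have := div_le_div_of_nonneg_right h hn0.le
          linarith
  -- `q² - 1 ≤ (2A + A²)/nK`
  have hsq : q ^ 2 - 1 ≤ (2 * A + A ^ 2) / nK := by
    have hAn : A / nK ≤ A := by
      rw [div_le_iff₀ hn0]; nlinarith
    have h1 : q - 1 ≤ A / nK := by linarith
    have h2 : q + 1 ≤ 2 + A := by linarith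
    calc q ^ 2 - 1 = (q - 1) * (q + 1) := by ring
      _ ≤ (A / nK) * (2 + A) := mul_le_mul h1 h2 (by linarith) (by positivity)
      _ = (2 * A + A ^ 2) / nK := by ring
  unfold concErr
  rw [← hCst, ← hq, ← Real.sqrt_div (by positivity : 0 ≤ 2 * A + A ^ 2)]
  exact Real.sqrt_le_sqrt hsq

end Literature.Probability.LatticeModels
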